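import Summits.CriticalPhenomena.PercolationContinuityZ3.Theorems.PercNearOneGluingNoHeavyQuantExponentCeilings
import HarnessLib

/-!
# PAPER-2 track, ARM-3 gen 3: the two-box hyperscaling transfers — `(T1) with exponent c` ⇒ critical volume tail with
# exponent `c/(d−c)` ⇒ the one-arm ceiling `c ≤ d/3` in EVERY dimension and `(T2)` with exponent `2c/(d−c)`

builds on p205010 (kernel theorem, internal audit signed; external expert review pending).
Status sentence for p205010: "θ(p_c) = 0 on ℤ^d, all d ≥ 2 — kernel-verified (Lean 4/Mathlib, standard
axioms); internal adversarial audit SIGNED 2026-08-20 04:29Z; external expert review pending."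

Seat `prim-quant-arm-3` (gen 3), `--supports stmt-CriticalPhenomena-4575`; pure proofs, no definitions.  Notation:
`P_p = bondPercolation (zdGraph d) p`, `p_c = criticalProbI d`, `π_p(n) = oneArmProb d p n = P_p(0 ↔ ∂Λ_n)`,
`τ_p(0,x) = tau d p 0 x`, `θ(p) = theta (zdGraph d) 0 p`.

The tree's (T1) ⇒ volume ⇒ (T2) dictionary (`ThetaModulus.volumeTail_of_oneArmDecay`, exponent `c/d`, then Newman's
`β ≥ 2/δ`, `ThetaModulus.thetaHolderNearCritical_of_volumeTail`) truncates the cluster by the WHOLE box, `|C ∩ Λ_n| ≤ |Λ_n|`.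
Replacing that by the two-disjoint-boxes bound `τ_p(0,x) ≤ π_p(⌊(‖x‖_∞−1)/2⌋)²` (tree, `tau_le_oneArmProb_sq_of_coord`) and Markov
(tree, `real_clusterSizeGe_le_oneArmProb_add`) — the mechanism of Borgs–Chayes–Kesten–Spencer's `dρ ≥ δ + 1` and of
Dewan–Muirhead's `η₁ ≤ d/(δ+1)` — gives, for EVERY `d ≥ 2` and with no existence-of-exponents assumption:

* `Quant.sum_tau_box_le_of_oneArmDecay` — `π_p(m) ≤ C m^{−c}` (`m ≥ 1`, `2c ≤ d − 1`) ⇒ `Σ_{x∈Λ_n} τ_p(0,x) ≤ K n^{d−2c}`,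
  `K = 5^d + 2d·3^{d−1}·16^c·C²`;
* `Quant.volumeTail_of_oneArmDecay_twoBox` — ⇒ `P_p(|C(0)| ≥ k) ≤ (2^c C + K) k^{−c/(d−c)}` (`k ≥ 1`): in exponent language
  `1/δ ≥ (1/ρ)/(d − 1/ρ)`, i.e. `dρ ≥ δ + 1`, which hyperscaling predicts to be an EQUALITY for `d ≤ 6`;
* **`Quant.oneArmPolyDecayAtCritical_exponent_le_third`** — any instance of `OneArmPolyDecayAtCritical d c C` has **`c ≤ d/3`**
  (compose with the tree's `δ ≥ 2` in power form, `ThetaModulus.volumeTail_exponent_le_half`: `c/(d−c) ≤ 1/2`).  This is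
  Dewan–Muirhead's Thm. 1.1 `η₁ ≤ d/3` for Bernoulli percolation as a statement about the lane's predicate; the tree had its
  instance `c = 2 ⇒ d ≥ 6` (`six_le_of_oneArm_upper`) and the ceiling `c ≤ (d−1)/2` (`oneArmPolyDecayAtCritical_exponent_le`), which
  `d/3` improves for every `d ≥ 4` (`4/3 < 3/2`, `5/3 < 2`, `2 < 5/2`): at the upper critical dimension `d = 6` the admissible window
  is `0 < c ≤ 2`, the mean-field value being extremal (`oneArmPolyDecayAtCritical_exponent_le_two_of_six`);
* **`Quant.thetaHolderNearCritical_of_oneArmPolyDecay_twoBox`** — `OneArmPolyDecayAtCritical d c C ⇒ ThetaHolderNearCritical d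
  (2c/(d−c)) C''`, improving the tree's exponent `2c/d` (`thetaHolderNearCritical_of_oneArmPolyDecay_volume`); SHARP in mean
  field: `(d, c) = (6, 2) ↦ 2c/(d−c) = 1 = β` (vs `2c/d = 2/3`); for `d = 3` with the numerical `c ≈ 0.48` (orientation only)
  `2c/(d−c) ≈ 0.38` vs `2c/d ≈ 0.32` vs the predicted `β ≈ 0.42`.

Honest reading.  The ceiling is UNCONDITIONAL; the two transfers are REDUCTIONS whose hypothesis (T1) is open for `3 ≤ d ≤ 10`
(now "open for `0 < c ≤ min((d−1)/2, d/3)`", i.e. `c ≤ 1, 4/3, 5/3, 2` in `d = 3, 4, 5, 6`).  Nothing here is a rate; the `d = 3`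
class of the lane's results (iterated-logarithm) is unchanged.  Memo: `run/shared/lean/prim/quant/prim-quant-arm-3/POWERLAW-SURVEY.md` §11.

## References
* V. Dewan, S. Muirhead, Probab. Theory Relat. Fields 185 (2023) 41–88 (arXiv:2102.12123): Thm. 1.1 (`η₁ ≤ d/3`), §2 [DewanMuirhead2022].
* C. Borgs, J. T. Chayes, H. Kesten, J. Spencer, Random Struct. Alg. 15 (1999) 368–413: §1 (`dρ ≥ δ + 1`, `η₁ ≤ d/(1+δ)`) [BorgsChayesKestenSpencer1999].
* M. Heydenreich, R. van der Hofstad (2017), proof of Cor. 11.7, (11.4.1)–(11.4.2) [HeydenreichVanDerHofstad2017]; C. M. Newman, J. Stat. Phys. 47 (1987) 695–699 [Newman1987BetaDelta].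
-/

noncomputable section

namespace Summit.CriticalPhenomena.PercolationContinuityZ3.Theorems.Quant

open MeasureTheory Finset Literature.Probability.Percolation Literature.Probability.LatticeModels
open Literature.Barriers.CriticalPhenomena (tau_le_oneArmProb_sq_of_coord real_clusterSizeGe_le_oneArmProb_add
  sum_box_sdiff_box_eq_sum_Ico card_sphere_succ_le')
open scoped Classical

variable {d : ℕ}

/-! ### §1. The two-box shell sum: `Σ_{x∈Λ_n} τ_p(0,x) ≤ K n^{d−2c}` under `π_p(m) ≤ C m^{−c}` -/

section ShellSum

/-- **Expected cluster size in a box under a one-arm power bound (two disjoint boxes).**  On `ℤ^d`, `d ≥ 1`, at any `p`: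
if `π_p(m) ≤ C m^{−c}` for all `m ≥ 1`, with `c ≥ 0` and `2c ≤ d − 1`, then for all `n ≥ 1`
`Σ_{x ∈ Λ_n} τ_p(0,x) ≤ (5^d + 2d·3^{d−1}·16^c·C²) · n^{d−2c}`: on `Λ_2`, `τ ≤ 1` and `|Λ_2| = 5^d`; for `‖x‖_∞ = k ≥ 3` the
two-boxes bound with `m = ⌊(k−1)/2⌋` (`2m+1 ≤ k ≤ 4m`) gives `τ_p(0,x) ≤ (C m^{−c})² ≤ 16^c C² k^{−2c}`, and
`Σ_{3 ≤ k ≤ n} |∂Λ_k| k^{−2c} ≤ 2d·3^{d−1} Σ_{k ≤ n} k^{d−1−2c} ≤ 2d·3^{d−1} n^{d−2c}`.  The tree's `sum_tau_box_le_of_oneArm_upper`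
is the case `c = 2`, `d ≤ 5`.  Mechanism: Dewan–Muirhead 2023 §2 / Heydenreich–van der Hofstad (11.4.2); new as stated.
[cite: DewanMuirhead2022, §2 (proof of Thm. 1.1: Σ_{v∈Λ_R} P[A₁(⌊|v|/2⌋)]² ≲ R^{d−2η})]
[cite: HeydenreichVanDerHofstad2017, proof of Cor. 11.7, (11.4.1)–(11.4.2)] -/
theorem sum_tau_box_le_of_oneArmDecay (hd1 : 1 ≤ d) (p : unitInterval) {c C : ℝ} (hc : 0 ≤ c)
    (h2c : 2 * c ≤ (d : ℝ) - 1)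
    (hρ : ∀ m : ℕ, 1 ≤ m → oneArmProb d p m ≤ C * (m : ℝ) ^ (-c)) {n : ℕ} (hn : 1 ≤ n) :
    ∑ x ∈ box d n, tau d p 0 x ≤ (5 ^ d + 2 * d * 3 ^ (d - 1) * (16 : ℝ) ^ c * C ^ 2) * (n : ℝ) ^ ((d : ℝ) - 2 * c) := by
  classical
  have hn1 : (1 : ℝ) ≤ n := by exact_mod_cast hn
  have hn0 : (0 : ℝ) < n := by linarith
  have hdc0 : 0 ≤ (d : ℝ) - 2 * c := by linarith
  have hdc1 : 0 ≤ (d : ℝ) - 1 - 2 * c := by linarith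
  have hnpow1 : (1 : ℝ) ≤ (n : ℝ) ^ ((d : ℝ) - 2 * c) := Real.one_le_rpow hn1 hdc0
  have hsmall : ∀ m : ℕ, m ≤ 2 → ∑ x ∈ box d m, tau d p 0 x ≤ 5 ^ d := by
    intro m hm
    calc ∑ x ∈ box d m, tau d p 0 x ≤ ∑ x ∈ box d 2, tau d p 0 x :=
          Finset.sum_le_sum_of_subset_of_nonneg (box_mono d hm) fun x _ _ => tau_nonneg p 0 x
      _ ≤ ∑ _x ∈ box d 2, (1 : ℝ) := Finset.sum_le_sum fun x _ => tau_le_one p 0 x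
      _ = 5 ^ d := by
          rw [Finset.sum_const, card_box, nsmul_eq_mul, mul_one]
          norm_num
  have hK2 : (0 : ℝ) ≤ 2 * d * 3 ^ (d - 1) * (16 : ℝ) ^ c * C ^ 2 := by positivity
  have h5 : (5 : ℝ) ^ d ≤ 5 ^ d * (n : ℝ) ^ ((d : ℝ) - 2 * c) := le_mul_of_one_le_right (by positivity) hnpow1
  rcases le_or_gt n 2 with hn2 | hn2
  · calc ∑ x ∈ box d n, tau d p 0 x ≤ 5 ^ d := hsmall n hn2
      _ ≤ 5 ^ d * (n : ℝ) ^ ((d : ℝ) - 2 * c) +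
            2 * d * 3 ^ (d - 1) * (16 : ℝ) ^ c * C ^ 2 * (n : ℝ) ^ ((d : ℝ) - 2 * c) := by
          nlinarith [mul_nonneg hK2 (le_trans zero_le_one hnpow1)]
      _ = (5 ^ d + 2 * d * 3 ^ (d - 1) * (16 : ℝ) ^ c * C ^ 2) * (n : ℝ) ^ ((d : ℝ) - 2 * c) := by ring
  · have h2n : 2 ≤ n := by omega
    have hpt : ∀ x ∈ box d n \ box d 2,
        tau d p 0 x ≤ (16 : ℝ) ^ c * C ^ 2 * (((Site.supNorm x : ℕ) : ℝ)) ^ (-(2 * c)) := by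
      intro x hx
      obtain ⟨-, hx2⟩ := Finset.mem_sdiff.1 hx
      rw [mem_box_iff_supNorm_le, not_le] at hx2
      have hne : (Finset.univ : Finset (Fin d)).Nonempty :=
        Finset.univ_nonempty_iff.2 ⟨⟨0, by omega⟩⟩
      obtain ⟨i, hi⟩ := Site.exists_natAbs_eq_supNorm hne x
      set k := Site.supNorm x with hk
      set m : ℕ := (k - 1) / 2 with hm
      have hm1 : 1 ≤ m := by omega
      have h2m : 2 * m + 1 ≤ k := by omega
      have hk4m : k ≤ 4 * m := by omega
      have hvi : 2 * (m : ℤ) + 1 ≤ |x i| := by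
        rw [← Int.natCast_natAbs, hi]
        exact_mod_cast h2m
      have h1 := tau_le_oneArmProb_sq_of_coord m p i hvi
      have hπ := hρ m hm1
      have hπ0 : 0 ≤ oneArmProb d p m := measureReal_nonneg
      have hm0 : (0 : ℝ) < m := by exact_mod_cast hm1
      have hk0 : (0 : ℝ) < k := by exact_mod_cast (show 0 < k by omega)
      have hkm : (k : ℝ) / 4 ≤ m := by
        have : (k : ℝ) ≤ 4 * m := by exact_mod_cast hk4m
        linarith
      have hmc : (m : ℝ) ^ (-c) ≤ ((k : ℝ) / 4) ^ (-c) :=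
        Real.rpow_le_rpow_of_nonpos (by positivity) hkm (by linarith)
      have hk4 : ((k : ℝ) / 4) ^ (-c) = (4 : ℝ) ^ c * (k : ℝ) ^ (-c) := by
        rw [Real.div_rpow hk0.le (by norm_num : (0 : ℝ) ≤ 4), Real.rpow_neg (by norm_num : (0 : ℝ) ≤ 4) c,
          div_inv_eq_mul, mul_comm]
      have hCm : C * (m : ℝ) ^ (-c) ≤ C * ((4 : ℝ) ^ c * (k : ℝ) ^ (-c)) := by
        have hC0 : 0 ≤ C * (m : ℝ) ^ (-c) := hπ0.trans hπ
        have hC : 0 ≤ C := by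
          by_contra hC
          push Not at hC
          have : C * (m : ℝ) ^ (-c) < 0 := mul_neg_of_neg_of_pos hC (Real.rpow_pos_of_pos hm0 _)
          linarith
        rw [← hk4]
        exact mul_le_mul_of_nonneg_left hmc hC
      have hsq : (C * ((4 : ℝ) ^ c * (k : ℝ) ^ (-c))) ^ 2 = (16 : ℝ) ^ c * C ^ 2 * (k : ℝ) ^ (-(2 * c)) := by
        have h16 : ((4 : ℝ) ^ c) ^ 2 = (16 : ℝ) ^ c := by
          rw [← Real.rpow_natCast, ← Real.rpow_mul (by norm_num)]
          rw [show (16 : ℝ) = 4 ^ (2 : ℝ) by norm_num, ← Real.rpow_mul (by norm_num)]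
          ring_nf
        have hk2 : ((k : ℝ) ^ (-c)) ^ 2 = (k : ℝ) ^ (-(2 * c)) := by
          rw [← Real.rpow_natCast, ← Real.rpow_mul hk0.le]
          ring_nf
        calc (C * ((4 : ℝ) ^ c * (k : ℝ) ^ (-c))) ^ 2 = C ^ 2 * (((4 : ℝ) ^ c) ^ 2 * ((k : ℝ) ^ (-c)) ^ 2) := by ring
          _ = (16 : ℝ) ^ c * C ^ 2 * (k : ℝ) ^ (-(2 * c)) := by rw [h16, hk2]; ring
      calc tau d p 0 x ≤ oneArmProb d p m ^ 2 := h1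
        _ ≤ (C * (m : ℝ) ^ (-c)) ^ 2 := pow_le_pow_left₀ hπ0 hπ 2
        _ ≤ (C * ((4 : ℝ) ^ c * (k : ℝ) ^ (-c))) ^ 2 := pow_le_pow_left₀ (hπ0.trans hπ) hCm 2
        _ = (16 : ℝ) ^ c * C ^ 2 * (k : ℝ) ^ (-(2 * c)) := hsq
    have hsplit : ∑ x ∈ box d n, tau d p 0 x =
        ∑ x ∈ box d n \ box d 2, tau d p 0 x + ∑ x ∈ box d 2, tau d p 0 x :=
      (Finset.sum_sdiff (box_mono d h2n)).symm
    have hshell : ∀ k ∈ Finset.Ico 2 n, (#(sphere d (k + 1)) : ℝ) * ((((k + 1 : ℕ) : ℝ)) ^ (-(2 * c))) ≤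
        2 * d * 3 ^ (d - 1) * (n : ℝ) ^ ((d : ℝ) - 1 - 2 * c) := by
      intro k hk
      have hkn : k + 1 ≤ n := (Finset.mem_Ico.1 hk).2
      have hcard := card_sphere_succ_le' (d := d) hd1 k
      have hk1 : (1 : ℝ) ≤ (k : ℝ) + 1 := by
        have : (0 : ℝ) ≤ k := Nat.cast_nonneg k
        linarith
      have hk0 : (0 : ℝ) < (k : ℝ) + 1 := by linarith
      have hkn' : (k : ℝ) + 1 ≤ n := by exact_mod_cast hkn
      have hpow : ((k : ℝ) + 1) ^ (d - 1) * ((k : ℝ) + 1) ^ (-(2 * c)) = ((k : ℝ) + 1) ^ ((d : ℝ) - 1 - 2 * c) := by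
        rw [← Real.rpow_natCast, ← Real.rpow_add hk0]
        congr 1
        rw [Nat.cast_sub hd1]
        push_cast
        ring
      have hmono : ((k : ℝ) + 1) ^ ((d : ℝ) - 1 - 2 * c) ≤ (n : ℝ) ^ ((d : ℝ) - 1 - 2 * c) :=
        Real.rpow_le_rpow hk0.le hkn' hdc1
      push_cast
      calc (#(sphere d (k + 1)) : ℝ) * (((k : ℝ) + 1) ^ (-(2 * c)))
          ≤ 2 * d * 3 ^ (d - 1) * ((k : ℝ) + 1) ^ (d - 1) * (((k : ℝ) + 1) ^ (-(2 * c))) :=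
            mul_le_mul_of_nonneg_right hcard (Real.rpow_nonneg hk0.le _)
        _ = 2 * d * 3 ^ (d - 1) * (((k : ℝ) + 1) ^ (d - 1) * ((k : ℝ) + 1) ^ (-(2 * c))) := by ring
        _ = 2 * d * 3 ^ (d - 1) * ((k : ℝ) + 1) ^ ((d : ℝ) - 1 - 2 * c) := by rw [hpow]
        _ ≤ 2 * d * 3 ^ (d - 1) * (n : ℝ) ^ ((d : ℝ) - 1 - 2 * c) :=
            mul_le_mul_of_nonneg_left hmono (by positivity)
    have hnn : (n : ℝ) * (n : ℝ) ^ ((d : ℝ) - 1 - 2 * c) = (n : ℝ) ^ ((d : ℝ) - 2 * c) := by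
      rw [show ((d : ℝ) - 2 * c) = 1 + ((d : ℝ) - 1 - 2 * c) by ring, Real.rpow_add hn0, Real.rpow_one]
    have hann : ∑ x ∈ box d n \ box d 2, tau d p 0 x ≤
        (16 : ℝ) ^ c * C ^ 2 * (2 * d * 3 ^ (d - 1) * (n : ℝ) ^ ((d : ℝ) - 2 * c)) := by
      calc ∑ x ∈ box d n \ box d 2, tau d p 0 x
          ≤ ∑ x ∈ box d n \ box d 2, (16 : ℝ) ^ c * C ^ 2 * (((Site.supNorm x : ℕ) : ℝ)) ^ (-(2 * c)) :=
            Finset.sum_le_sum hpt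
        _ = (16 : ℝ) ^ c * C ^ 2 *
              ∑ x ∈ box d n \ box d 2, (fun k : ℕ => ((k : ℝ)) ^ (-(2 * c))) (Site.supNorm x) := by
            rw [Finset.mul_sum]
        _ = (16 : ℝ) ^ c * C ^ 2 *
              ∑ k ∈ Finset.Ico 2 n, (#(sphere d (k + 1)) : ℝ) * ((((k + 1 : ℕ) : ℝ)) ^ (-(2 * c))) := by
            rw [sum_box_sdiff_box_eq_sum_Ico (fun k : ℕ => ((k : ℝ)) ^ (-(2 * c))) h2n]
        _ ≤ (16 : ℝ) ^ c * C ^ 2 * ∑ _k ∈ Finset.Ico 2 n, (2 * d * 3 ^ (d - 1) * (n : ℝ) ^ ((d : ℝ) - 1 - 2 * c)) :=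
            mul_le_mul_of_nonneg_left (Finset.sum_le_sum hshell) (by positivity)
        _ = (16 : ℝ) ^ c * C ^ 2 * (((n - 2 : ℕ) : ℝ) * (2 * d * 3 ^ (d - 1) * (n : ℝ) ^ ((d : ℝ) - 1 - 2 * c))) := by
            rw [Finset.sum_const, Nat.card_Ico, nsmul_eq_mul]
        _ ≤ (16 : ℝ) ^ c * C ^ 2 * ((n : ℝ) * (2 * d * 3 ^ (d - 1) * (n : ℝ) ^ ((d : ℝ) - 1 - 2 * c))) := by
            gcongr
            exact_mod_cast Nat.sub_le n 2
        _ = (16 : ℝ) ^ c * C ^ 2 * (2 * d * 3 ^ (d - 1) * ((n : ℝ) * (n : ℝ) ^ ((d : ℝ) - 1 - 2 * c))) := by ring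
        _ = (16 : ℝ) ^ c * C ^ 2 * (2 * d * 3 ^ (d - 1) * (n : ℝ) ^ ((d : ℝ) - 2 * c)) := by rw [hnn]
    calc ∑ x ∈ box d n, tau d p 0 x
        = ∑ x ∈ box d n \ box d 2, tau d p 0 x + ∑ x ∈ box d 2, tau d p 0 x := hsplit
      _ ≤ (16 : ℝ) ^ c * C ^ 2 * (2 * d * 3 ^ (d - 1) * (n : ℝ) ^ ((d : ℝ) - 2 * c)) + 5 ^ d :=
          add_le_add hann (hsmall 2 le_rfl)
      _ ≤ (16 : ℝ) ^ c * C ^ 2 * (2 * d * 3 ^ (d - 1) * (n : ℝ) ^ ((d : ℝ) - 2 * c)) +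
            5 ^ d * (n : ℝ) ^ ((d : ℝ) - 2 * c) := add_le_add le_rfl h5
      _ = (5 ^ d + 2 * d * 3 ^ (d - 1) * (16 : ℝ) ^ c * C ^ 2) * (n : ℝ) ^ ((d : ℝ) - 2 * c) := by ring

end ShellSum

/-! ### §2. (T1)-type bound ⇒ volume tail with exponent `c/(d−c)` (BCKS's `dρ ≥ δ + 1` in power form) -/

section VolumeTwoBox

/-- **One-arm power bound ⇒ volume tail with the hyperscaling exponent `c/(d−c)`.**  On `ℤ^d`, `d ≥ 1`, at any `p`: if
`π_p(m) ≤ C m^{−c}` for all `m ≥ 1` with `c > 0`, `2c ≤ d − 1`, then for all `k ≥ 1`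
`P_p(|C(0)| ≥ k) ≤ (2^c C + 5^d + 2d·3^{d−1}·16^c·C²) · k^{−c/(d−c)}`: by the squeeze
`P_p(|C(0)| ≥ k) ≤ π_p(n) + (Σ_{x∈Λ_n} τ_p(0,x))/k` (tree) with `n = ⌊k^{1/(d−c)}⌋` and §1, both terms are `≲ k^{−c/(d−c)}`.
In exponent language this is `δ + 1 ≤ dρ` (Borgs–Chayes–Kesten–Spencer), one half of the hyperscaling relation `dρ = δ + 1`
expected for `d ≤ 6`, here with no existence-of-exponents assumption; the tree's `volumeTail_of_oneArmDecay` has the cruder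
`c/d` (whole-box truncation).  New as stated; mechanism BCKS 1999 §1 / Dewan–Muirhead 2023 §2.
[cite: BorgsChayesKestenSpencer1999, §1 (dρ ≥ δ+1)] [cite: DewanMuirhead2022, §2 (proof of Thm. 1.1)] -/
theorem volumeTail_of_oneArmDecay_twoBox (hd1 : 1 ≤ d) (p : unitInterval) {c C : ℝ} (hc : 0 < c)
    (h2c : 2 * c ≤ (d : ℝ) - 1)
    (hρ : ∀ m : ℕ, 1 ≤ m → oneArmProb d p m ≤ C * (m : ℝ) ^ (-c)) (k : ℕ) (hk : 1 ≤ k) :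
    (bondPercolation (zdGraph d) p).real (clusterSizeGe (0 : Site d) k) ≤
      ((2 : ℝ) ^ c * C + (5 ^ d + 2 * d * 3 ^ (d - 1) * (16 : ℝ) ^ c * C ^ 2)) * (k : ℝ) ^ (-(c / ((d : ℝ) - c))) := by
  set K : ℝ := 5 ^ d + 2 * d * 3 ^ (d - 1) * (16 : ℝ) ^ c * C ^ 2 with hKdef
  have hK0 : 0 ≤ K := by positivity
  have hC : 0 ≤ C := by
    have h1 := hρ 1 le_rfl
    simp only [Nat.cast_one, Real.one_rpow, mul_one] at h1
    exact le_trans (by unfold oneArmProb; exact measureReal_nonneg) h1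
  have hk1 : (1 : ℝ) ≤ k := by exact_mod_cast hk
  have hk0 : (0 : ℝ) < k := by linarith
  have hdc : 0 < (d : ℝ) - c := by linarith
  have hdc2 : 0 ≤ (d : ℝ) - 2 * c := by linarith
  set r : ℝ := (k : ℝ) ^ (1 / ((d : ℝ) - c)) with hrdef
  have hr1 : 1 ≤ r := Real.one_le_rpow hk1 (by positivity)
  have hr0 : 0 < r := by linarith
  set n : ℕ := ⌊r⌋₊ with hndef
  have hn1 : 1 ≤ n := by
    rw [hndef, Nat.one_le_floor_iff]
    exact hr1
  have hn0 : (0 : ℝ) < n := by exact_mod_cast hn1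
  have hnr : (n : ℝ) ≤ r := Nat.floor_le hr0.le
  have hrn : r < n + 1 := Nat.lt_floor_add_one r
  have hr2n : r / 2 ≤ n := by
    have : (1 : ℝ) ≤ n := by exact_mod_cast hn1
    linarith
  have hsq := real_clusterSizeGe_le_oneArmProb_add (d := d) p n hk
  have hS := sum_tau_box_le_of_oneArmDecay hd1 p hc.le h2c hρ hn1
  have hπ := hρ n hn1
  have hrk : r ^ ((d : ℝ) - c) = k := by
    rw [hrdef, ← Real.rpow_mul hk0.le, one_div, inv_mul_cancel₀ hdc.ne', Real.rpow_one]
  have hterm1 : C * (n : ℝ) ^ (-c) ≤ (2 : ℝ) ^ c * C * (k : ℝ) ^ (-(c / ((d : ℝ) - c))) := by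
    have h1 : (n : ℝ) ^ (-c) ≤ (r / 2) ^ (-c) :=
      Real.rpow_le_rpow_of_nonpos (by positivity) hr2n (by linarith)
    have h2 : (r / 2) ^ (-c) = (2 : ℝ) ^ c * (k : ℝ) ^ (-(c / ((d : ℝ) - c))) := by
      rw [Real.div_rpow hr0.le (by norm_num : (0 : ℝ) ≤ 2), Real.rpow_neg (by norm_num : (0 : ℝ) ≤ 2) c,
        div_inv_eq_mul, mul_comm, hrdef, ← Real.rpow_mul hk0.le]
      rw [show 1 / ((d : ℝ) - c) * -c = -(c / ((d : ℝ) - c)) by field_simp]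
    calc C * (n : ℝ) ^ (-c) ≤ C * (r / 2) ^ (-c) := mul_le_mul_of_nonneg_left h1 hC
      _ = (2 : ℝ) ^ c * C * (k : ℝ) ^ (-(c / ((d : ℝ) - c))) := by rw [h2]; ring
  have hterm2 : K * (n : ℝ) ^ ((d : ℝ) - 2 * c) / k ≤ K * (k : ℝ) ^ (-(c / ((d : ℝ) - c))) := by
    have h1 : (n : ℝ) ^ ((d : ℝ) - 2 * c) ≤ r ^ ((d : ℝ) - 2 * c) := Real.rpow_le_rpow hn0.le hnr hdc2
    have h2 : r ^ ((d : ℝ) - 2 * c) / k = (k : ℝ) ^ (-(c / ((d : ℝ) - c))) := by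
      rw [hrdef, ← Real.rpow_mul hk0.le, div_eq_mul_inv, ← Real.rpow_neg_one, ← Real.rpow_add hk0]
      congr 1
      field_simp
      ring
    calc K * (n : ℝ) ^ ((d : ℝ) - 2 * c) / k ≤ K * r ^ ((d : ℝ) - 2 * c) / k := by
          gcongr
      _ = K * (r ^ ((d : ℝ) - 2 * c) / k) := by ring
      _ = K * (k : ℝ) ^ (-(c / ((d : ℝ) - c))) := by rw [h2]
  calc (bondPercolation (zdGraph d) p).real (clusterSizeGe (0 : Site d) k)
      ≤ oneArmProb d p n + (∑ x ∈ box d n, tau d p 0 x) / k := hsq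
    _ ≤ C * (n : ℝ) ^ (-c) + K * (n : ℝ) ^ ((d : ℝ) - 2 * c) / k := by
        gcongr
    _ ≤ (2 : ℝ) ^ c * C * (k : ℝ) ^ (-(c / ((d : ℝ) - c))) + K * (k : ℝ) ^ (-(c / ((d : ℝ) - c))) :=
        add_le_add hterm1 hterm2
    _ = ((2 : ℝ) ^ c * C + K) * (k : ℝ) ^ (-(c / ((d : ℝ) - c))) := by ring

/-- **(T1) ⇒ critical volume tail with exponent `c/(d−c)`**: `OneArmPolyDecayAtCritical d c C` (`d ≥ 2`, `c > 0`) implies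
`P_{p_c}(|C(0)| ≥ k) ≤ A k^{−c/(d−c)}` for all `k ≥ 1`, `A = 2^c C + 5^d + 2d·3^{d−1}·16^c·C²` — the side condition `2c ≤ d − 1`
of `volumeTail_of_oneArmDecay_twoBox` being automatic at `p_c` (tree ceiling `oneArmPolyDecayAtCritical_exponent_le`).
Conditional on (T1) (open for `3 ≤ d ≤ 10`); the exponent is the one hyperscaling predicts (`1/δ = (1/ρ)/(d − 1/ρ)`).
builds on p205010 (kernel theorem, internal audit signed; external expert review pending) (not used: pure dictionary).
[cite: BorgsChayesKestenSpencer1999, §1 (dρ ≥ δ+1)] -/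
theorem volumeTail_criticalProbI_of_oneArmPolyDecay (hd : 2 ≤ d) {c C : ℝ} (hc : 0 < c)
    (h : OneArmPolyDecayAtCritical d c C) (k : ℕ) (hk : 1 ≤ k) :
    (bondPercolation (zdGraph d) (criticalProbI d)).real (clusterSizeGe (0 : Site d) k) ≤
      ((2 : ℝ) ^ c * C + (5 ^ d + 2 * d * 3 ^ (d - 1) * (16 : ℝ) ^ c * C ^ 2)) * (k : ℝ) ^ (-(c / ((d : ℝ) - c))) := by
  have hce := oneArmPolyDecayAtCritical_exponent_le hd h
  have h2c : 2 * c ≤ (d : ℝ) - 1 := by linarith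
  exact volumeTail_of_oneArmDecay_twoBox (by omega) (criticalProbI d) hc h2c (fun m hm => h m hm) k hk

end VolumeTwoBox

/-! ### §3. The one-arm ceiling `c ≤ d/3` in every dimension (Dewan–Muirhead's `η₁ ≤ d/(δ+1) ≤ d/3`, power form) -/

section Ceiling

/-- **One-arm exponent ceiling `c ≤ d/3`** (every `d ≥ 2`, UNCONDITIONAL): an instance of `OneArmPolyDecayAtCritical d c C`
has `c ≤ d/3`.  Proof: for `c > 0`, §2 gives a critical volume tail with exponent `c/(d−c)`, and `δ ≥ 2` in power form
(tree, `ThetaModulus.volumeTail_exponent_le_half`, from Aizenman–Barsky's magnetization bound) forces `c/(d−c) ≤ 1/2`, i.e.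
`c ≤ d/3`; for `c ≤ 0` there is nothing to prove.  This is Dewan–Muirhead's Thm. 1.1 (`η₁ ≤ d/3` for Bernoulli percolation on
`ℤ^d`) as a statement about the lane's predicate, assuming no existence of exponents; it improves the tree's ceiling
`c ≤ (d−1)/2` (`oneArmPolyDecayAtCritical_exponent_le`) for every `d ≥ 4` and contains `six_le_of_oneArm_upper` (`c = 2 ⇒ d ≥ 6`).
New as a typed statement; mechanism Dewan–Muirhead 2023 / BCKS 1999.
[cite: DewanMuirhead2022, Thm. 1.1 (η₁ ≤ d/3) and §2] [cite: BorgsChayesKestenSpencer1999, §1 (η₁ ≤ d/(1+δ))]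
[cite: AizenmanBarsky1987, Thm. 1.2 (δ ≥ 2)] -/
theorem oneArmPolyDecayAtCritical_exponent_le_third (hd : 2 ≤ d) {c C : ℝ} (h : OneArmPolyDecayAtCritical d c C) :
    c ≤ (d : ℝ) / 3 := by
  rcases le_or_gt c 0 with hc | hc
  · have : (0 : ℝ) ≤ (d : ℝ) / 3 := by positivity
    linarith
  have hce := oneArmPolyDecayAtCritical_exponent_le hd h
  have hdc : 0 < (d : ℝ) - c := by linarith
  have ha0 : 0 < c / ((d : ℝ) - c) := div_pos hc hdc
  have hhalf := ThetaModulus.volumeTail_exponent_le_half hd ha0 (volumeTail_criticalProbI_of_oneArmPolyDecay hd hc h)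
  rw [div_le_iff₀ hdc] at hhalf
  linarith

/-- The two ceilings together: `c ≤ min((d−1)/2, d/3)` for every instance of `OneArmPolyDecayAtCritical d c C`, `d ≥ 2`
(`(d−1)/2` is the smaller for `d ≤ 3`, `d/3` for `d ≥ 3`; they agree at `d = 3`: `c ≤ 1`).  Unconditional. -/
theorem oneArmPolyDecayAtCritical_exponent_le_min (hd : 2 ≤ d) {c C : ℝ} (h : OneArmPolyDecayAtCritical d c C) :
    c ≤ min (((d : ℝ) - 1) / 2) ((d : ℝ) / 3) :=
  le_min (oneArmPolyDecayAtCritical_exponent_le hd h) (oneArmPolyDecayAtCritical_exponent_le_third hd h)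

/-- `d = 4`: any instance of `OneArmPolyDecayAtCritical 4 c C` has `c ≤ 4/3` (the tree's ceiling gave `3/2`).  Unconditional. -/
theorem oneArmPolyDecayAtCritical_exponent_le_of_four {c C : ℝ} (h : OneArmPolyDecayAtCritical 4 c C) : c ≤ 4 / 3 := by
  have := oneArmPolyDecayAtCritical_exponent_le_third (d := 4) (by norm_num) h
  norm_num at this
  linarith

/-- `d = 5`: any instance of `OneArmPolyDecayAtCritical 5 c C` has `c ≤ 5/3` (the tree's ceiling gave `2`).  Unconditional. -/
theorem oneArmPolyDecayAtCritical_exponent_le_of_five {c C : ℝ} (h : OneArmPolyDecayAtCritical 5 c C) : c ≤ 5 / 3 := by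
  have := oneArmPolyDecayAtCritical_exponent_le_third (d := 5) (by norm_num) h
  norm_num at this
  linarith

/-- **`d = 6`: the mean-field exponent is extremal at the upper critical dimension** — any instance of
`OneArmPolyDecayAtCritical 6 c C` has `c ≤ 2` (the tree's ceiling gave `5/2`; `2` is Kozma–Nachmias's high-dimensional value,
expected at `d = 6` with a logarithmic correction).  Unconditional. [cite: DewanMuirhead2022, Thm. 1.1 and §1.1] -/
theorem oneArmPolyDecayAtCritical_exponent_le_two_of_six {c C : ℝ} (h : OneArmPolyDecayAtCritical 6 c C) : c ≤ 2 := by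
  have := oneArmPolyDecayAtCritical_exponent_le_third (d := 6) (by norm_num) h
  norm_num at this
  linarith

/-- The lane-vocabulary form of `six_le_of_oneArm_upper`: an instance of `OneArmPolyDecayAtCritical d c C` with `c ≥ 2`
(in particular the mean-field one-arm bound `π_{p_c}(n) ≤ C n^{−2}`) forces `d ≥ 6`.  Unconditional.
[cite: DewanMuirhead2022, §1.1 ("η₁ = 2 cannot occur for d ≤ 5")] -/
theorem six_le_of_oneArmPolyDecayAtCritical (hd : 2 ≤ d) {c C : ℝ} (hc : 2 ≤ c) (h : OneArmPolyDecayAtCritical d c C) :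
    6 ≤ d := by
  have h3 := oneArmPolyDecayAtCritical_exponent_le_third hd h
  have h6 : (6 : ℝ) ≤ d := by linarith
  exact_mod_cast h6

end Ceiling

/-! ### §4. The improved (T1) ⇒ (T2) transfer: exponent `2c/(d−c)` -/

section Holder

/-- **(T1) ⇒ (T2) with exponent `2c/(d−c)`** (improves the tree's `2c/d` of `thetaHolderNearCritical_of_oneArmPolyDecay_volume`
and `2c/(c+d)` of R4.b): `OneArmPolyDecayAtCritical d c C` with `c > 0` implies `ThetaHolderNearCritical d (2c/(d−c)) C''`, with
`C''` Newman's constant of `ThetaModulus.thetaHolderNearCritical_of_volumeTail` at `a = c/(d−c)`, `A = 2^c C + 5^d + 2d·3^{d−1}·16^c·C²`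
(`a ≤ 1/2 < 1` by §3).  SHARP in mean field: `(d, c) = (6, 2) ↦ 2c/(d−c) = 1 = β`; for `d = 3` and the numerical `c ≈ 0.48`
(orientation only) `2c/(d−c) ≈ 0.38` against the predicted `β ≈ 0.42` (the loss is Newman's `β ≥ 2/δ`, not the volume step,
which is the hyperscaling equality).  Conditional on (T1) (open for `3 ≤ d ≤ 10`); the reduction is new.
builds on p205010 (kernel theorem, internal audit signed; external expert review pending) (not used: pure dictionary).
[cite: Newman1987BetaDelta, Theorem (β ≥ 2/δ)] [cite: BorgsChayesKestenSpencer1999, §1 (dρ ≥ δ+1)] -/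
theorem thetaHolderNearCritical_of_oneArmPolyDecay_twoBox (hd : 2 ≤ d) {c C : ℝ} (hc : 0 < c)
    (h : OneArmPolyDecayAtCritical d c C) :
    ThetaHolderNearCritical d (2 * c / ((d : ℝ) - c))
      (2 * (((2 : ℝ) ^ c * C + (5 ^ d + 2 * d * 3 ^ (d - 1) * (16 : ℝ) ^ c * C ^ 2)) * (3 / (1 - c / ((d : ℝ) - c)))) *
          (2 * d * (1 / (criticalProbI d : ℝ) ^ 2 + 1 / (1 - (criticalProbI d : ℝ)) ^ 2)) ^ (c / ((d : ℝ) - c)) +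
        (1 / min (criticalProbI d : ℝ) (1 - criticalProbI d)) ^ (2 * c / ((d : ℝ) - c))) := by
  have hce := oneArmPolyDecayAtCritical_exponent_le hd h
  have hdc : 0 < (d : ℝ) - c := by linarith
  have ha0 : 0 < c / ((d : ℝ) - c) := div_pos hc hdc
  have hA := volumeTail_criticalProbI_of_oneArmPolyDecay hd hc h
  have hhalf := ThetaModulus.volumeTail_exponent_le_half hd ha0 hA
  have ha1 : c / ((d : ℝ) - c) < 1 := by linarith
  have hH := ThetaModulus.thetaHolderNearCritical_of_volumeTail hd ha0 ha1 hA
  rw [show 2 * (c / ((d : ℝ) - c)) = 2 * c / ((d : ℝ) - c) by ring] at hH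
  exact hH

/-- Existential form of the improved transfer: `OneArmPolyDecayAtCritical d c C` (`c > 0`) ⇒
`∃ C'', ThetaHolderNearCritical d (2c/(d−c)) C''`.  Conditional on (T1); new. -/
theorem exists_thetaHolderNearCritical_of_oneArmPolyDecay_twoBox (hd : 2 ≤ d) {c C : ℝ} (hc : 0 < c)
    (h : OneArmPolyDecayAtCritical d c C) :
    ∃ C'' : ℝ, ThetaHolderNearCritical d (2 * c / ((d : ℝ) - c)) C'' :=
  ⟨_, thetaHolderNearCritical_of_oneArmPolyDecay_twoBox hd hc h⟩

end Holder

end Summit.CriticalPhenomena.PercolationContinuityZ3.Theorems.Quant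
end
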